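import Summits.AtomisticToContinuum.Crystallization.Theorems.ExcessDecayLiouvillePhononStabilityCertModel
import Mathlib.Analysis.Convex.Deriv
import Mathlib.Analysis.Calculus.Deriv.ZPow

/-!
# Near-certificate layer V5-a: slice calculus (lead c2, vertex scheme)

Support file for crux `PhononStability` (stmt-AtomisticToContinuum-9333), line `contragredient-window-collapse`.

The vertex interpolation lemma (`…CertInterp.lean`) needs, along every coordinate slice of a grid cell, the concavity of
`t ↦ f(t) − (M/2)t²` for the class functions `f`.  Along a slice every class function is a finite sum of terms
`φ(ρ(t))·q(t)` with `φ ∈ {ω̃, ψ̃}` (the Lennard-Jones pair coefficients as functions of the SQUARED length,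
`ω(r) = ω̃(r²)`, `ψ(r) = ψ̃(r²)`), `ρ(t)` a quadratic polynomial (affine along strain slices) and `q(t)` a quadratic
polynomial (the pair form of a matrix polynomial at a fixed test field).  This file provides the generic calculus:
inverse-power combinations and their derivatives (`ipc`), the first two derivatives of `ω̃, ψ̃` (`omegaT`, `psiT` of
`…CertModel.lean`), the slice terms
`sliceG` with explicit first and second derivatives, and the concavity criterion `concaveOn_sliceSum` from a pointwise
bound on the explicit second derivative (`concaveOn_of_hasDerivWithinAt2_nonpos`).
-/

noncomputable section

open scoped BigOperators
open Set

namespace Summit.AtomisticToContinuum.Crystallization.Theorems.PhononStabilityCWC.Cert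

/-! ## Inverse-power combinations -/

/-- `ipc a m b n ρ = a ρ^m + b ρ^n` (integer exponents). -/
def ipc (a : ℝ) (m : ℤ) (b : ℝ) (n : ℤ) (ρ : ℝ) : ℝ := a * ρ ^ m + b * ρ ^ n

/-- derivative of an inverse-power combination away from `0`. [folklore] -/
theorem hasDerivAt_ipc (a : ℝ) (m : ℤ) (b : ℝ) (n : ℤ) {ρ : ℝ} (hρ : ρ ≠ 0) :
    HasDerivAt (ipc a m b n) (ipc (a * m) (m - 1) (b * n) (n - 1) ρ) ρ := by
  have h1 := (hasDerivAt_zpow m ρ (Or.inl hρ)).const_mul a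
  have h2 := (hasDerivAt_zpow n ρ (Or.inl hρ)).const_mul b
  have h := h1.add h2
  refine h.congr_deriv ?_
  unfold ipc
  ring

/-- `ω̃ = ipc 14 (−8) (−8) (−5)` (`omegaT` of the model layer). [folklore] -/
theorem omegaT_eq_ipc : omegaT = ipc 14 (-8) (-8) (-5) := by
  funext ρ
  unfold omegaT ipc
  rw [show ((-8 : ℤ)) = -((8 : ℕ) : ℤ) by norm_num, show ((-5 : ℤ)) = -((5 : ℕ) : ℤ) by norm_num,
    zpow_neg, zpow_neg, zpow_natCast, zpow_natCast, inv_pow, inv_pow]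
  ring

/-- `ψ̃ = ipc (−1) (−7) 1 (−4)` (`psiT` of the model layer). [folklore] -/
theorem psiT_eq_ipc : psiT = ipc (-1) (-7) 1 (-4) := by
  funext ρ
  unfold psiT ipc
  rw [show ((-7 : ℤ)) = -((7 : ℕ) : ℤ) by norm_num, show ((-4 : ℤ)) = -((4 : ℕ) : ℤ) by norm_num,
    zpow_neg, zpow_neg, zpow_natCast, zpow_natCast, inv_pow, inv_pow]
  ring

/-- `ω̃′`. -/
def omegaT1 : ℝ → ℝ := ipc (-112) (-9) 40 (-6)
/-- `ω̃″`. -/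
def omegaT2 : ℝ → ℝ := ipc 1008 (-10) (-240) (-7)
/-- `ψ̃′`. -/
def psiT1 : ℝ → ℝ := ipc 7 (-8) (-4) (-5)
/-- `ψ̃″`. -/
def psiT2 : ℝ → ℝ := ipc (-56) (-9) 20 (-6)

/-- `ω̃′` is the derivative of `ω̃`. [folklore] -/
theorem hasDerivAt_omegaT {ρ : ℝ} (hρ : ρ ≠ 0) : HasDerivAt omegaT (omegaT1 ρ) ρ := by
  have h := hasDerivAt_ipc 14 (-8) (-8) (-5) hρ
  rw [omegaT_eq_ipc]
  unfold omegaT1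
  convert h using 2 <;> norm_num

/-- `ω̃″` is the derivative of `ω̃′`. [folklore] -/
theorem hasDerivAt_omegaT1 {ρ : ℝ} (hρ : ρ ≠ 0) : HasDerivAt omegaT1 (omegaT2 ρ) ρ := by
  have h := hasDerivAt_ipc (-112) (-9) 40 (-6) hρ
  unfold omegaT1 omegaT2
  convert h using 2 <;> norm_num

/-- `ψ̃′` is the derivative of `ψ̃`. [folklore] -/
theorem hasDerivAt_psiT {ρ : ℝ} (hρ : ρ ≠ 0) : HasDerivAt psiT (psiT1 ρ) ρ := by
  have h := hasDerivAt_ipc (-1) (-7) 1 (-4) hρ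
  rw [psiT_eq_ipc]
  unfold psiT1
  convert h using 2 <;> norm_num

/-- `ψ̃″` is the derivative of `ψ̃′`. [folklore] -/
theorem hasDerivAt_psiT1 {ρ : ℝ} (hρ : ρ ≠ 0) : HasDerivAt psiT1 (psiT2 ρ) ρ := by
  have h := hasDerivAt_ipc 7 (-8) (-4) (-5) hρ
  unfold psiT1 psiT2
  convert h using 2 <;> norm_num

/-! ## Slice terms `φ(ρ(t))·q(t)` -/

/-- A slice term: outer function with its first two derivatives, a quadratic argument `ρ(t) = r0 + r1 t + r2 t²`
and a quadratic factor `q(t) = a0 + a1 t + a2 t²`. -/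
structure SliceTerm where
  /-- outer function -/
  φ : ℝ → ℝ
  /-- its derivative -/
  φ1 : ℝ → ℝ
  /-- its second derivative -/
  φ2 : ℝ → ℝ
  /-- argument coefficients -/
  r0 : ℝ
  /-- argument coefficients -/
  r1 : ℝ
  /-- argument coefficients -/
  r2 : ℝ
  /-- factor coefficients -/
  a0 : ℝ
  /-- factor coefficients -/
  a1 : ℝ
  /-- factor coefficients -/
  a2 : ℝ

namespace SliceTerm

variable (s : SliceTerm)

/-- the argument `ρ(t)` -/
def rho (t : ℝ) : ℝ := s.r0 + s.r1 * t + s.r2 * t ^ 2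
/-- `ρ′(t)` -/
def rho1 (t : ℝ) : ℝ := s.r1 + 2 * s.r2 * t
/-- the factor `q(t)` -/
def q (t : ℝ) : ℝ := s.a0 + s.a1 * t + s.a2 * t ^ 2
/-- `q′(t)` -/
def q1 (t : ℝ) : ℝ := s.a1 + 2 * s.a2 * t
/-- the term `g(t) = φ(ρ(t)) q(t)` -/
def g (t : ℝ) : ℝ := s.φ (s.rho t) * s.q t
/-- `g′ = φ′(ρ)ρ′ q + φ(ρ) q′` -/
def g1 (t : ℝ) : ℝ := s.φ1 (s.rho t) * s.rho1 t * s.q t + s.φ (s.rho t) * s.q1 t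
/-- `g″ = φ″(ρ)ρ′² q + φ′(ρ)(2 r2) q + 2 φ′(ρ) ρ′ q′ + φ(ρ) (2 a2)` -/
def g2 (t : ℝ) : ℝ :=
  s.φ2 (s.rho t) * s.rho1 t ^ 2 * s.q t + s.φ1 (s.rho t) * (2 * s.r2) * s.q t
    + 2 * s.φ1 (s.rho t) * s.rho1 t * s.q1 t + s.φ (s.rho t) * (2 * s.a2)

/-- The derivative hypotheses of a slice term: `φ′`, `φ″` are the derivatives of `φ`, `φ′` wherever `ρ > 0`. -/
structure DerivOK : Prop where
  /-- `φ1` is the derivative of `φ` on `(0, ∞)` -/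
  d1 : ∀ ρ : ℝ, 0 < ρ → HasDerivAt s.φ (s.φ1 ρ) ρ
  /-- `φ2` is the derivative of `φ1` on `(0, ∞)` -/
  d2 : ∀ ρ : ℝ, 0 < ρ → HasDerivAt s.φ1 (s.φ2 ρ) ρ

/-- derivative of the argument. [folklore] -/
theorem hasDerivAt_rho (t : ℝ) : HasDerivAt s.rho (s.rho1 t) t := by
  have h := ((hasDerivAt_const t s.r0).add ((hasDerivAt_id t).const_mul s.r1)).add
    (((hasDerivAt_id t).pow 2).const_mul s.r2)
  refine h.congr_deriv ?_
  unfold rho1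
  simp only [id, Nat.cast_ofNat]
  ring

/-- derivative of the factor. [folklore] -/
theorem hasDerivAt_q (t : ℝ) : HasDerivAt s.q (s.q1 t) t := by
  have h := ((hasDerivAt_const t s.a0).add ((hasDerivAt_id t).const_mul s.a1)).add
    (((hasDerivAt_id t).pow 2).const_mul s.a2)
  refine h.congr_deriv ?_
  unfold q1
  simp only [id, Nat.cast_ofNat]
  ring

/-- second derivative of the argument. [folklore] -/
theorem hasDerivAt_rho1 (t : ℝ) : HasDerivAt s.rho1 (2 * s.r2) t := by
  have h := (hasDerivAt_const t s.r1).add ((hasDerivAt_id t).const_mul (2 * s.r2))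
  refine h.congr_deriv ?_
  ring

/-- second derivative of the factor. [folklore] -/
theorem hasDerivAt_q1 (t : ℝ) : HasDerivAt s.q1 (2 * s.a2) t := by
  have h := (hasDerivAt_const t s.a1).add ((hasDerivAt_id t).const_mul (2 * s.a2))
  refine h.congr_deriv ?_
  ring

/-- **first derivative of a slice term** (where `ρ(t) > 0`). [folklore] -/
theorem hasDerivAt_g (hs : s.DerivOK) {t : ℝ} (ht : 0 < s.rho t) : HasDerivAt s.g (s.g1 t) t := by
  have hφ : HasDerivAt (fun t => s.φ (s.rho t)) (s.φ1 (s.rho t) * s.rho1 t) t :=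
    (hs.d1 _ ht).comp t (s.hasDerivAt_rho t)
  have h := hφ.mul (s.hasDerivAt_q t)
  refine h.congr_deriv ?_
  unfold g1
  ring

/-- **second derivative of a slice term** (where `ρ(t) > 0`). [folklore] -/
theorem hasDerivAt_g1 (hs : s.DerivOK) {t : ℝ} (ht : 0 < s.rho t) : HasDerivAt s.g1 (s.g2 t) t := by
  have hφ : HasDerivAt (fun t => s.φ (s.rho t)) (s.φ1 (s.rho t) * s.rho1 t) t :=
    (hs.d1 _ ht).comp t (s.hasDerivAt_rho t)
  have hφ1 : HasDerivAt (fun t => s.φ1 (s.rho t)) (s.φ2 (s.rho t) * s.rho1 t) t :=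
    (hs.d2 _ ht).comp t (s.hasDerivAt_rho t)
  have hA := (hφ1.mul (s.hasDerivAt_rho1 t)).mul (s.hasDerivAt_q t)
  have hB := hφ.mul (s.hasDerivAt_q1 t)
  have h := hA.add hB
  refine h.congr_deriv ?_
  unfold g2
  simp only [Pi.mul_apply]
  ring

end SliceTerm

/-! ## Concavity of a slice sum from a bound on the explicit second derivative -/

/-- the slice sum `Σ_m g_m(t) + (e0 + e1 t − e2 t²)` -/
def sliceSum (L : List SliceTerm) (e0 e1 e2 : ℝ) (t : ℝ) : ℝ := (L.map fun s => s.g t).sum + (e0 + e1 * t - e2 * t ^ 2)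
/-- its derivative -/
def sliceSum1 (L : List SliceTerm) (e1 e2 : ℝ) (t : ℝ) : ℝ := (L.map fun s => s.g1 t).sum + (e1 - 2 * e2 * t)
/-- its second derivative -/
def sliceSum2 (L : List SliceTerm) (e2 : ℝ) (t : ℝ) : ℝ := (L.map fun s => s.g2 t).sum - 2 * e2

/-- derivative of a list sum of functions. [folklore] -/
theorem hasDerivAt_listSum {L : List SliceTerm} {F F' : SliceTerm → ℝ → ℝ} {t : ℝ}
    (h : ∀ s ∈ L, HasDerivAt (F s) (F' s t) t) :
    HasDerivAt (fun t => (L.map fun s => F s t).sum) ((L.map fun s => F' s t).sum) t := by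
  induction L with
  | nil => simpa using hasDerivAt_const t 0
  | cons s rest ih =>
      simp only [List.map_cons, List.sum_cons]
      exact (h s (List.mem_cons_self ..)).add (ih fun s' hs' => h s' (List.mem_cons_of_mem _ hs'))

/-- derivative of a slice sum. [folklore] -/
theorem hasDerivAt_sliceSum {L : List SliceTerm} (hL : ∀ s ∈ L, s.DerivOK) (e0 e1 e2 : ℝ) {t : ℝ}
    (ht : ∀ s ∈ L, 0 < s.rho t) : HasDerivAt (sliceSum L e0 e1 e2) (sliceSum1 L e1 e2 t) t := by
  unfold sliceSum sliceSum1
  have h1 : HasDerivAt (fun t => (L.map fun s => s.g t).sum) ((L.map fun s => s.g1 t).sum) t :=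
    hasDerivAt_listSum fun s hs => s.hasDerivAt_g (hL s hs) (ht s hs)
  have h2 : HasDerivAt (fun t => e0 + e1 * t - e2 * t ^ 2) (e1 - 2 * e2 * t) t := by
    have h := ((hasDerivAt_const t e0).add ((hasDerivAt_id t).const_mul e1)).sub
      (((hasDerivAt_id t).pow 2).const_mul e2)
    refine h.congr_deriv ?_
    simp only [id, Nat.cast_ofNat]
    ring
  exact h1.add h2

/-- second derivative of a slice sum. [folklore] -/
theorem hasDerivAt_sliceSum1 {L : List SliceTerm} (hL : ∀ s ∈ L, s.DerivOK) (e1 e2 : ℝ) {t : ℝ}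
    (ht : ∀ s ∈ L, 0 < s.rho t) : HasDerivAt (sliceSum1 L e1 e2) (sliceSum2 L e2 t) t := by
  unfold sliceSum1 sliceSum2
  have h1 : HasDerivAt (fun t => (L.map fun s => s.g1 t).sum) ((L.map fun s => s.g2 t).sum) t :=
    hasDerivAt_listSum fun s hs => s.hasDerivAt_g1 (hL s hs) (ht s hs)
  have h2 : HasDerivAt (fun t => e1 - 2 * e2 * t) (-(2 * e2)) t := by
    have h := (hasDerivAt_const t e1).sub ((hasDerivAt_id t).const_mul (2 * e2))
    refine h.congr_deriv ?_
    ring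
  exact (h1.add h2).congr_deriv (by ring)

/-- **CONCAVITY CRITERION FOR A SLICE SUM:** if every term is differentiable in the above sense, the arguments stay
positive on `[a, b]` and the explicit second derivative is bounded by `M` there, then `t ↦ F(t) − (M/2)t²` is concave
on `[a, b]`. [folklore] -/
theorem concaveOn_sliceSum {L : List SliceTerm} (hL : ∀ s ∈ L, s.DerivOK) (e0 e1 e2 : ℝ) {a b M : ℝ}
    (hpos : ∀ t ∈ Icc a b, ∀ s ∈ L, 0 < s.rho t) (hbound : ∀ t ∈ Icc a b, sliceSum2 L e2 t ≤ M) :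
    ConcaveOn ℝ (Icc a b) (fun t => sliceSum L e0 e1 e2 t - M / 2 * t ^ 2) := by
  have hsq : ∀ t : ℝ, HasDerivAt (fun t => M / 2 * t ^ 2) (M * t) t := by
    intro t
    have h := ((hasDerivAt_id t).pow 2).const_mul (M / 2)
    refine h.congr_deriv ?_
    simp only [id, Nat.cast_ofNat]
    ring
  have hlin : ∀ t : ℝ, HasDerivAt (fun t => M * t) M t := by
    intro t
    exact ((hasDerivAt_id t).const_mul M).congr_deriv (mul_one M)
  have hint : interior (Icc a b) ⊆ Icc a b := interior_subset
  refine concaveOn_of_hasDerivWithinAt2_nonpos (convex_Icc a b) (f' := fun t => sliceSum1 L e1 e2 t - M * t)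
    (f'' := fun t => sliceSum2 L e2 t - M) ?_ ?_ ?_ ?_
  · intro t ht
    exact ((hasDerivAt_sliceSum hL e0 e1 e2 (hpos t ht)).sub (hsq t)).continuousAt.continuousWithinAt
  · intro t ht
    exact ((hasDerivAt_sliceSum hL e0 e1 e2 (hpos t (hint ht))).sub (hsq t)).hasDerivWithinAt
  · intro t ht
    exact ((hasDerivAt_sliceSum1 hL e1 e2 (hpos t (hint ht))).sub (hlin t)).hasDerivWithinAt
  · intro t ht
    have := hbound t (hint ht)
    show sliceSum2 L e2 t - M ≤ 0
    linarith

/-- Anchor of this support file (registered stub of the line skeleton, lead c2): `ω̃(1) = 6`. -/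
theorem stub_certSlice : omegaT 1 = 6 := by
  unfold omegaT; norm_num

end Summit.AtomisticToContinuum.Crystallization.Theorems.PhononStabilityCWC.Cert

end
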